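import Literature.NumberTheory.Sieve.ThetaHeckeExpansion
import HarnessLib

/-!
# The character `χ` on the totally positive units as a frequency of `logSpace K`

Topic `Literature/NumberTheory/Sieve`, sub-namespace `ThetaUnits` (continued). For the
quantitative harmonic analysis of `Θ_{Ω'}(χ)` uniform in the modulus `𝔣` we work on the FIXED
full lattice `L⁺ = posUnitLattice K` of logarithms of totally positive units (`ConeWeylSums`)
rather than on `L_𝔣`: the restriction of `χ` to `U⁺ ≅ L⁺` is a character of a free abelian
group, hence of the form `ℓ ↦ e(κ_χ(ℓ))` for a real linear functional `κ_χ` with bounded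
coefficients (Hecke 1920 §1: "Exponenten" of a character on the units):

* `logEquiv : U⁺ ≃* Multiplicative L⁺` (totally real `K`), `uOf ℓ` the unit with logarithm `ℓ`;
* `theta_ χ i ∈ (−1/2, 1/2]` — `χ(uOf bᵢ) = e(θᵢ)` on the basis `rBasis L⁺`;
* `kappa χ = ∑ᵢ θᵢ · coordᵢ : logSpace K →L[ℝ] ℝ`, **`unitChar_uOf : χ(uOf ℓ) = e(κ_χ(ℓ))`**,
  `unitChar_eq_e_kappa : χ(u) = e(κ_χ(log u))` for `u ∈ U⁺`;
* `abs_kappa_le` — `|κ_χ(v)| ≤ (1/2) ∑ᵢ |coordᵢ(v)|` (uniform in `χ` and `𝔣`).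

## References

* E. Hecke, Math. Z. 6 (1920), §1. [cite: HeckeMathZ1920, §1]
* T. Mitsui, Jap. J. Math. 26 (1956), §3. [cite: Mitsui1956, §3]
-/

noncomputable section

open NumberField NumberField.InfinitePlace NumberField.Units NumberField.Units.dirichletUnitTheorem
  Literature.NumberTheory.LFunctions Literature.NumberTheory.LFunctions.HeckeCone
  Literature.NumberTheory.LFunctions.AbelianDensity
  Literature.NumberTheory.Sieve.UnitKernel Literature.NumberTheory.Sieve.UnitPeriodic
  Literature.Algebra.EuclideanLattices.LatticePeriodic Module
open scoped Classical

namespace Literature.NumberTheory.Sieve.ThetaUnits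

variable {K : Type*} [Field K] [NumberField K] [IsTotallyReal K]

local notation "rkE" => finrank ℝ (logSpace K)

/-! ## `U⁺ ≃ L⁺` -/

variable (K) in
/-- **`U⁺ ≃* L⁺`** by the logarithmic embedding (totally real `K`). [folklore] -/
def logEquiv : posUnits K ≃* Multiplicative (posUnitLattice K) :=
  MulEquiv.ofBijective
    ({ toFun := fun u => Multiplicative.ofAdd ⟨logEmbedding K (Additive.ofMul (u : (𝓞 K)ˣ)), logEmbedding_mem_posUnitLattice u.2⟩
       map_one' := by
         apply Multiplicative.toAdd.injective
         simp only [toAdd_ofAdd, toAdd_one, OneMemClass.coe_one, ofMul_one, map_zero]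
         rfl
       map_mul' := fun u v => by
         apply Multiplicative.toAdd.injective
         simp only [toAdd_ofAdd, toAdd_mul, Subgroup.coe_mul, ofMul_mul, map_add]
         rfl } : posUnits K →* Multiplicative (posUnitLattice K))
    ⟨fun u v h => by
      have h' := congrArg (fun x : Multiplicative (posUnitLattice K) => ((Multiplicative.toAdd x : posUnitLattice K) : logSpace K)) h
      simp only [MonoidHom.coe_mk, OneHom.coe_mk, toAdd_ofAdd] at h'
      exact Subtype.ext (logEmbedding_injOn_posUnits u.2 v.2 h'),
     fun x => by
      obtain ⟨u, hu, hux⟩ := exists_of_mem_posUnitLattice (Multiplicative.toAdd x).2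
      refine ⟨⟨u, hu⟩, ?_⟩
      apply Multiplicative.toAdd.injective
      exact Subtype.ext hux⟩

/-- The value of `logEquiv`. [folklore] -/
theorem logEquiv_apply (u : posUnits K) :
    ((Multiplicative.toAdd (logEquiv K u) : posUnitLattice K) : logSpace K) = logEmbedding K (Additive.ofMul (u : (𝓞 K)ˣ)) := rfl

variable (K) in
/-- `uOf ℓ`: the totally positive unit with logarithm `ℓ ∈ L⁺`. [folklore] -/
def uOf (ℓ : posUnitLattice K) : posUnits K := (logEquiv K).symm (Multiplicative.ofAdd ℓ)

/-- `log (uOf ℓ) = ℓ`. [folklore] -/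
theorem logEmbedding_uOf (ℓ : posUnitLattice K) :
    logEmbedding K (Additive.ofMul ((uOf K ℓ : posUnits K) : (𝓞 K)ˣ)) = (ℓ : logSpace K) := by
  have h := (logEquiv K).apply_symm_apply (Multiplicative.ofAdd ℓ)
  have h2 := congrArg (fun x : Multiplicative (posUnitLattice K) => ((Multiplicative.toAdd x : posUnitLattice K) : logSpace K)) h
  simp only [toAdd_ofAdd] at h2
  rw [← h2]
  rfl

/-- `uOf (log u) = u`. [folklore] -/
theorem uOf_logEquiv (u : posUnits K) : uOf K (Multiplicative.toAdd (logEquiv K u)) = u := by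
  unfold uOf
  rw [ofAdd_toAdd, MulEquiv.symm_apply_apply]

/-- `uOf` is a homomorphism: `uOf (ℓ + ℓ') = uOf ℓ · uOf ℓ'`. [folklore] -/
theorem uOf_add (ℓ ℓ' : posUnitLattice K) : uOf K (ℓ + ℓ') = uOf K ℓ * uOf K ℓ' := by
  unfold uOf
  rw [ofAdd_add, map_mul]

/-- `uOf 0 = 1`. [folklore] -/
theorem uOf_zero : uOf K (0 : posUnitLattice K) = 1 := by
  unfold uOf
  rw [ofAdd_zero, map_one]

/-- `uOf (n • ℓ) = (uOf ℓ)^n`. [folklore] -/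
theorem uOf_zsmul (n : ℤ) (ℓ : posUnitLattice K) : uOf K (n • ℓ) = uOf K ℓ ^ n := by
  unfold uOf
  rw [ofAdd_zsmul, map_zpow]

/-! ## The frequency `κ_χ` of `χ` on the units -/

variable {𝔣 : Ideal (𝓞 K)} (χ : AddChar (Additive ((𝓞 K ⧸ 𝔣)ˣ)) ℂ)

/-- `e(x) = exp(2πi x)`. [folklore] -/
def eC (x : ℝ) : ℂ := Complex.exp (2 * Real.pi * Complex.I * x)

omit [IsTotallyReal K] in
/-- `e(x + y) = e(x) e(y)`. [folklore] -/
theorem eC_add (x y : ℝ) : eC (x + y) = eC x * eC y := by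
  unfold eC; rw [← Complex.exp_add]; push_cast; ring_nf

/-- `uOf` over a finite sum. [folklore] -/
theorem uOf_sum {ι : Type*} (s : Finset ι) (f : ι → posUnitLattice K) : uOf K (∑ i ∈ s, f i) = ∏ i ∈ s, uOf K (f i) := by
  unfold uOf
  rw [ofAdd_sum, map_prod]

/-- `θᵢ`: `χ(uOf bᵢ) = e(θᵢ)` with `θᵢ = arg(χ(uOf bᵢ))/(2π) ∈ (−1/2, 1/2]`, `bᵢ = zBasis L⁺ i`.
[cite: HeckeMathZ1920, §1] -/
def theta_ (i : Fin rkE) : ℝ :=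
  Complex.arg (unitChar χ ((uOf K (zBasis (posUnitLattice K) i) : posUnits K) : (𝓞 K)ˣ)) / (2 * Real.pi)

/-- **The frequency `κ_χ = ∑ᵢ θᵢ coordᵢ`** of `χ` on the units. [cite: HeckeMathZ1920, §1] -/
def kappa : logSpace K →L[ℝ] ℝ :=
  LinearMap.toContinuousLinearMap (∑ i, theta_ χ i • (rBasis (posUnitLattice K)).coord i)

/-- Unfolding `kappa`. [folklore] -/
theorem kappa_apply (v : logSpace K) : kappa χ v = ∑ i, theta_ χ i * (rBasis (posUnitLattice K)).repr v i := by
  simp [kappa, Basis.coord_apply]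

/-- **`|κ_χ(v)| ≤ (1/2) ∑ᵢ |coordᵢ(v)|`**, uniformly in `χ`. [folklore] -/
theorem abs_kappa_le (v : logSpace K) : |kappa χ v| ≤ (1 / 2) * ∑ i, |(rBasis (posUnitLattice K)).repr v i| := by
  rw [kappa_apply, Finset.mul_sum]
  refine (Finset.abs_sum_le_sum_abs _ _).trans (Finset.sum_le_sum fun i _ => ?_)
  rw [abs_mul]
  refine mul_le_mul_of_nonneg_right ?_ (abs_nonneg _)
  rw [theta_, abs_div, abs_of_pos (by positivity : (0 : ℝ) < 2 * Real.pi), div_le_iff₀ (by positivity)]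
  have h1 := Complex.abs_arg_le_pi (unitChar χ ((uOf K (zBasis (posUnitLattice K) i) : posUnits K) : (𝓞 K)ˣ))
  linarith

/-- On the basis: `χ(uOf bᵢ) = e(θᵢ)` (values of `χ` on units are unimodular; `𝔣 ≠ 0`). [folklore] -/
theorem unitChar_uOf_zBasis [Finite (𝓞 K ⧸ 𝔣)] (i : Fin rkE) :
    unitChar χ ((uOf K (zBasis (posUnitLattice K) i) : posUnits K) : (𝓞 K)ˣ) = eC (theta_ χ i) := by
  set z := unitChar χ ((uOf K (zBasis (posUnitLattice K) i) : posUnits K) : (𝓞 K)ˣ) with hz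
  have hnorm : ‖z‖ = 1 := by rw [hz, unitChar_apply]; exact norm_toMulHom _ _
  have h := Complex.norm_mul_exp_arg_mul_I z
  rw [hnorm, Complex.ofReal_one, one_mul] at h
  rw [eC, theta_]
  conv_lhs => rw [← h]
  congr 1
  rw [← hz]
  push_cast
  field_simp

omit [NumberField K] [IsTotallyReal K] in
/-- `χ(u⁻¹) = χ(u)⁻¹` on units. [folklore] -/
theorem unitChar_inv (u : (𝓞 K)ˣ) : unitChar χ u⁻¹ = (unitChar χ u)⁻¹ := by
  have h : unitChar χ u⁻¹ * unitChar χ u = 1 := by rw [← map_mul, inv_mul_cancel, map_one]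
  have hne : unitChar χ u ≠ 0 := fun h0 => by rw [h0, mul_zero] at h; exact zero_ne_one h
  exact eq_inv_of_mul_eq_one_left h

omit [IsTotallyReal K] in
/-- `e(n x) = e(x)^n`. [folklore] -/
theorem eC_int_mul (n : ℤ) (x : ℝ) : eC ((n : ℝ) * x) = eC x ^ n := by
  unfold eC
  rw [← Complex.exp_int_mul]
  push_cast
  ring_nf

omit [IsTotallyReal K] in
/-- `e` of a finite sum. [folklore] -/
theorem eC_sum {ι : Type*} (s : Finset ι) (f : ι → ℝ) : eC (∑ i ∈ s, f i) = ∏ i ∈ s, eC (f i) := by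
  induction s using Finset.induction_on with
  | empty => simp [eC]
  | insert a s ha ih => rw [Finset.sum_insert ha, Finset.prod_insert ha, eC_add, ih]

/-- **`χ(uOf ℓ) = e(κ_χ(ℓ))` for every `ℓ ∈ L⁺`.** [cite: HeckeMathZ1920, §1] -/
theorem unitChar_uOf [Finite (𝓞 K ⧸ 𝔣)] (ℓ : posUnitLattice K) :
    unitChar χ ((uOf K ℓ : posUnits K) : (𝓞 K)ˣ) = eC (kappa χ (ℓ : logSpace K)) := by
  set b := zBasis (posUnitLattice K) with hb
  -- `ℓ = ∑ nᵢ • bᵢ`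
  have hsum : ℓ = ∑ i, (b.repr ℓ i) • b i := (b.sum_repr ℓ).symm
  conv_lhs => rw [hsum]
  rw [uOf_sum, Subgroup.val_finsetProd, map_prod]
  -- each factor
  have hfac : ∀ i, unitChar χ (((uOf K ((b.repr ℓ i) • b i) : posUnits K) : (𝓞 K)ˣ)) = eC (theta_ χ i) ^ (b.repr ℓ i) := by
    intro i
    rw [uOf_zsmul, Subgroup.coe_zpow, map_zpow' (unitChar χ) (unitChar_inv χ), hb, unitChar_uOf_zBasis χ i]
  rw [Finset.prod_congr rfl fun i _ => hfac i]
  -- the right-hand side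
  rw [kappa_apply]
  have hrepr : ∀ i, (rBasis (posUnitLattice K)).repr (ℓ : logSpace K) i = (b.repr ℓ i : ℝ) := fun i => by
    rw [rBasis, hb, Basis.ofZLatticeBasis_repr_apply]
  rw [Finset.sum_congr rfl fun i _ => by rw [hrepr i], eC_sum]
  refine Finset.prod_congr rfl fun i _ => ?_
  rw [← eC_int_mul, mul_comm]

/-- **`χ(u) = e(κ_χ(log u))` for every totally positive unit `u`.** [cite: HeckeMathZ1920, §1] -/
theorem unitChar_eq_eC_kappa [Finite (𝓞 K ⧸ 𝔣)] (u : posUnits K) :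
    unitChar χ (u : (𝓞 K)ˣ) = eC (kappa χ (logEmbedding K (Additive.ofMul (u : (𝓞 K)ˣ)))) := by
  have h := unitChar_uOf χ (Multiplicative.toAdd (logEquiv K u))
  rw [uOf_logEquiv] at h
  rw [h, logEquiv_apply]

end Literature.NumberTheory.Sieve.ThetaUnits
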